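/-
Copyright: lit-balaban Phase-2 proof seat p08 (gen 9).  Statement-level skeleton of a published paper; no proof claims beyond what
the kernel checks below.
-/
import Literature.MathematicalPhysics.QuantumFieldTheory.BalabanImbrieJaffe1984to88.BIJ88OpDecay213DkLocTorus
import Literature.MathematicalPhysics.QuantumFieldTheory.BalabanImbrieJaffe1984to88.BIJ85Sect72AllTori
import Literature.MathematicalPhysics.QuantumFieldTheory.BalabanImbrieJaffe1984to88.BIJ85Prop12PerTower

/-!
# `BalabanImbrieJaffe1984to88.BIJ88Decay213DkLocAllTori` — T. Bałaban, J. Imbrie, A. Jaffe, *Effective action and cluster properties of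
the abelian Higgs model*, Commun. Math. Phys. **114** (1988) 257–315 [BalabanImbrieJaffe1988], Sect. 2 p. 261 [PDF 5]: **(2.13) FOR THE
CONCRETE `𝒟_{k,loc}` OF RECORD — HYPOTHESIS-FREE PER TORUS, AND WITH CONSTANTS CHOSEN BEFORE THE TORUS** given [6I] Proposition 1.2 by
its tree name over the ALL-TORI index (file 3 of 3 of seat p08 gen 9: the quantifier bookkeeping of files 1–2,
`BIJ88CurlyDkLocDecayTorus` / `BIJ88OpDecay213DkLocTorus`, along p16's all-tori (7.2.2) `BIJ85Sect72AllTori`).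

statement-level skeleton of published theorems with citation tags; proofs where landed; nothing here is a claim about the Yang–Mills mass gap

PDF held: `paper:balaban1988-cmp114-bij-abelian-higgs-effective-action` (journal page = PDF page + 256), p. 261 [PDF 5] (text layer
re-read this session); [I] = [BalabanImbrieJaffe1985] p. 325 [PDF 27] (7.2.2) *"there exists δ > 0 and … M = M(α)"*; [6I] =
[Balaban1984PropagatorsI] Prop. 1.2 p. 35 *"independent of k, T_η"* (tree name `Balaban1983to89.B5.Prop12Printed`).

CITATION HEADER (lean-in-tree rule).  Part of the lit-balaban TYPED SKELETON (HOME `run/shared/lean/pub/lit-balaban/`), Phase-2 proof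
seat p08 (gen 9), unit `lit-balaban-p08`; free-target protocol G.5-34(d), TAKING line HOME/STATUS.md 2026-08-21T21:04:47Z (files A/B) and
the (2.23)/(2.26)/𝒟_{k,loc} all-tori slot left free by p16 g7 / r18 g10 (HOME/lit-balaban-r18/INBOX.md 21:13:58Z, seat INBOX 21:17:51Z).
WHAT IS REPRODUCED = SKELETON row **C2.Eq2.13** (owner r18, referee ref-5), first clause, kind «model instance» for r18's `dkLocKer`, in
the two quantifier shapes the cell records (typing note G-C1-07, adopted for C2 §§1–4 in r18's ROWS-C2 v1.76): PER TOWER with no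
hypothesis at all (p16's `BIJ85Prop12PerTower.prop12Printed_levStd_deltaA`: the per-tower `∃`-form of «[6I] Prop. 1.2 by name» is
finite bookkeeping), and OVER ALL TORI with ONE set of constants from the all-tori `B5.Prop12Printed` (p16's
`BIJ85Sect72AllTori.exists_absH_le_allTori_of_prop12Printed` + `abs_H_zero_le` for the scale-0 summand; p09's (2.5)-analogue `cloc_decay`
has `(d, L)`-only constants already).  Decls used BY NAME (nothing restated): files 1–2's explicit-constant theorems `abs_dkLocKer_le`,
`abs_dkLocKer_le_diag`, `abs_apply_dkLoc_le`, `decayDkLoc_torus_prop12`, `opDecay213_dkLoc_prop12`, `opDecay213_dkLoc_typed_prop12`; p16's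
names above; p09 g8's `cloc_decay`; r18's `dkLocKer`/`kdist`/`applyK`/`supNorm`/`suppDist`/`OpDecay`.  Sibling: p16 g7's
`BIJ85Sect72AllTori.decayDk_allTori_of_prop12Printed` (the same bookkeeping for the unlocalized `𝒟_k` of p08 g8).

THE PRINTED TEXT (p. 261 [PDF 5], verbatim): *"Thus |(𝒟_{k,loc}f)(b)| ≦ ce^{−c dist(suppt f, b)}‖f‖_∞ (2.13)"*; p. 259 *"c denotes
constants that may change from line to line"*, the constants of Sect. 2 being uniform in `k` and in the volume `T_η` ([6I] p. 35).

WHAT IS PROVED (0 `sorry`, standard axioms; theorems only — proof lane):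
* §1 PER TORUS, NO HYPOTHESIS (`2 ≤ P.d`): **`decayDkLoc_torus`** (kernel decay beyond a threshold), **`opDecay213_dkLoc_torus`** (the
  printed operator form, all `b`), `opDecay213_dkLoc_typed_torus` (r18's one-letter `OpDecay` in a rescaled distance) — files 1–2 with
  their `h12` discharged by p16's `prop12Printed_levStd_deltaA`; constants per torus `P`, uniform in `k ≤ m + K` and in the radius
  schedule `ρ`.
* §2 OVER ALL TORI, CONSTANTS BEFORE THE TORUS (`2 ≤ d`, `L` odd `> 1`, all-tori `B5.Prop12Printed`): **`decayDkLoc_allTori_of_prop12Printed`**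
  (ONE `(R₀, c₀, δ′)`: `|𝒟_{k,loc}(b,b″)| ≤ c₀e^{−δ′dist_k}` beyond `R₀` on EVERY torus `(P.d = d, P.L = L)`, every `k ≤ m + K`, every `ρ`),
  **`diag_dkLoc_allTori_of_prop12Printed`** (ONE `C`: `|𝒟_{k,loc}(b,b″)| ≤ C·Σ_{j<k}(L^{k−j})^{d−2}` everywhere — the diagonal size),
  **`opDecay213_dkLoc_allTori_of_prop12Printed`** (ONE `(c₁, δ′)`: `|Σ_{b″}η_k^d𝒟_{k,loc}(b,b″)f(b″)| ≤ c₁e^{−δ′dist_k(suppt f,b)}‖f‖_∞`, all `b`),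
  **`opDecay213_dkLoc_typed_allTori_of_prop12Printed`** (ONE `(κ, c)` for r18's `OpDecay`).
HONEST SCOPE.  Pure quantifier bookkeeping over files 1–2 (whose explicit constants depend on `(M, δ, M_C, δ_C, d)` only); the all-tori
«[6I] Prop. 1.2 by its tree name» is the hypothesis `h12` of §2 exactly as in p16's/r18's all-tori files (its bridge from p37's
`prop12_famG_printed` is p19/p30's, in flight); the `η^d`-weighted reading of `(𝒟_{k,loc}f)(b)` is file 2's (stated there with its in-tree
witnesses); derivative/Hölder clauses of (2.13) not covered.  No `def`, no new named fact, nothing restated; NOT summit progress.  Unit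
`lit-balaban-p08` (literature-prover-lit-balaban-p08-g9-0), 2026-08-21.
-/

open scoped BigOperators RealInnerProductSpace

namespace Literature.MathematicalPhysics.QuantumFieldTheory.BalabanImbrieJaffe1984to88.BIJ88Decay213DkLocAllTori

open Balaban1983to89 hiding Site Plaq
open Balaban1983to89.LatticeFieldCalculus
open BIJ85Prop521Torus BIJ85Prop522Torus BIJ85Sigma422Eta
open BIJ85Sect7Statements BIJ85Ineq722Torus
open BIJ85Ineq722DeltaA (deltaAData)
open BIJ85Ineq722ProofPart2 (settingOf)
open BIJ88ClocFactorsTorus (distB distB_apply)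
open BIJ88ClocEstimatesTorus (Cloc cloc_decay)
open BIJ88Sect2Statements (applyK supNorm suppDist OpDecay)
open BIJ88Close235Proof (supNorm_nonneg)
open BIJ85Sect72AllTori (exists_absH_le_allTori_of_prop12Printed abs_H_zero_le)
open BIJ85Prop12PerTower (prop12Printed_levStd_deltaA)
open BIJ88CurlyDkLocTorus BIJ88CurlyDkLocDecayTorus BIJ88OpDecay213DkLocTorus
-- inside this namespace the bare `Site`/`Plaq` are the `ℤ^d` carriers of the QFT root; the torus ones are renamed:
open Balaban1983to89 renaming Site → TSite, Plaq → TPlaq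

noncomputable section

/-! ## §1  Per torus, no hypothesis -/

section PerTower

variable {P : Params}

/-- **THE KERNEL DECAY OF (2.13) ON EVERY TORUS, NO HYPOTHESIS** (`d ≥ 2`): `∃ R₀ c₀ δ′, 0 < δ′ ∧ 0 ≤ c₀ ∧ ∀ k ≤ m + K, ∀ ρ, ∀ b b″,
R₀ ≤ dist_k(b,b″) → |𝒟_{k,loc}(b,b″)| ≤ c₀e^{−δ′dist_k(b,b″)}` for r18's `dkLocKer` at the printed weights — file 1's `decayDkLoc_torus_prop12`
with its `h12` discharged by p16's `prop12Printed_levStd_deltaA` (constants per torus; typing note G-C1-07).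
[cite: BalabanImbrieJaffe1988, (2.13) p.261] -/
theorem decayDkLoc_torus (hd : 2 ≤ P.d) {a : ℝ} (ha : 0 < a) :
    ∃ R₀ c₀ δ' : ℝ, 0 < δ' ∧ 0 ≤ c₀ ∧ ∀ (k : ℕ) (_ : k ≤ P.m + P.K) (ρ : ℕ → ℝ) (b b'' : PBond P 0),
        R₀ ≤ kdist (P := P) k b b'' →
        |dkLocKer (P := P) ((P.eta k) ^ P.d) ((P.L : ℝ) ^ k) ρ k b b''| ≤ c₀ * Real.exp (-δ' * kdist (P := P) k b b'') :=
  decayDkLoc_torus_prop12 hd ha (prop12Printed_levStd_deltaA P a)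

/-- **THE PRINTED OPERATOR FORM OF (2.13) ON EVERY TORUS, NO HYPOTHESIS** (`d ≥ 2`; the `η^d`-weighted action of file 2):
`∃ c₁ δ′, 0 < δ′ ∧ 0 ≤ c₁ ∧ ∀ k ≤ m + K, ∀ ρ f b, |Σ_{b″}η_k^d𝒟_{k,loc}(b,b″)f(b″)| ≤ c₁e^{−δ′dist_k(suppt f,b)}‖f‖_∞` — ALL `b`, no threshold.
[cite: BalabanImbrieJaffe1988, (2.13) p.261] -/
theorem opDecay213_dkLoc_torus (hd : 2 ≤ P.d) {a : ℝ} (ha : 0 < a) :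
    ∃ c₁ δ' : ℝ, 0 < δ' ∧ 0 ≤ c₁ ∧ ∀ (k : ℕ) (_ : k ≤ P.m + P.K) (ρ : ℕ → ℝ) (f : PBond P 0 → ℝ) (b : PBond P 0),
        |applyK (fun b b'' => (P.eta k) ^ P.d * dkLocKer (P := P) ((P.eta k) ^ P.d) ((P.L : ℝ) ^ k) ρ k b b'') f b| ≤
          c₁ * Real.exp (-δ' * suppDist (fun a b => kdist (P := P) k a b) f b) * supNorm f :=
  opDecay213_dkLoc_prop12 hd ha (prop12Printed_levStd_deltaA P a)

/-- **r18's typed row `OpDecay` INHABITED ON EVERY TORUS, NO HYPOTHESIS** (`d ≥ 2`; rescaled distance `κ·dist_k`).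
[cite: BalabanImbrieJaffe1988, (2.13) p.261] -/
theorem opDecay213_dkLoc_typed_torus (hd : 2 ≤ P.d) {a : ℝ} (ha : 0 < a) :
    ∃ κ c : ℝ, 0 < κ ∧ 0 < c ∧ ∀ (k : ℕ) (_ : k ≤ P.m + P.K) (ρ : ℕ → ℝ),
      OpDecay (fun a b => κ * kdist (P := P) k a b)
        (fun b b'' => (P.eta k) ^ P.d * dkLocKer (P := P) ((P.eta k) ^ P.d) ((P.L : ℝ) ^ k) ρ k b b'') c :=
  opDecay213_dkLoc_typed_prop12 hd ha (prop12Printed_levStd_deltaA P a)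

end PerTower

/-! ## §2  Over all tori, constants before the torus -/

section AllTori

/-- the two per-scale inputs of files 1–2 on a torus `P` of the all-tori index, from the all-tori `|H|` member of (7.2.2) (scale `0` by
`H_0 = I`) and p09's all-tori (2.5)-analogue for `C^{(j)}_{loc}`. [cite: BalabanImbrieJaffe1985, (7.2.2) p.325] -/
private theorem inputs_allTori {d L : ℕ} {a δ M MC δC : ℝ} (ha : 0 < a) (hM : 1 ≤ M)
    (hH : ∀ (P : Params) (_ : P.d = d) (_ : P.L = L) (k : ℕ) (_ : 1 ≤ k) (hk : k ≤ P.m + P.K)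
      (μ ν : Fin P.d) (x : TSite P 0) (y : TSite P k),
      |(torusRep P k (deltaAData hk a)).H (x, μ) (y, ν)| ≤ M * Real.exp (-(δ * distEU P k x y)))
    (hC : ∀ (P : Params), P.d = d → P.L = L → ∀ (j : ℕ) (_ : DecidableEq (PBond P j)),
      j + 1 ≤ P.m + P.K → ∀ (R : ℝ) (b b' : PBond P j), |Cloc P j R b b'| ≤ MC * Real.exp (-(δC * distB P j b b')))
    {P : Params} (hPd : P.d = d) (hPL : P.L = L) {k : ℕ} (hk : k ≤ P.m + P.K) (ρ : ℕ → ℝ) :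
    (∀ (j : ℕ) (hj : j ≤ P.m + P.K), j < k → ∀ (μ ν : Fin P.d) (x : TSite P 0) (y : TSite P j),
      |(torusRep P j (deltaAData hj a)).H (x, μ) (y, ν)| ≤ M * Real.exp (-(δ * distEU P j x y))) ∧
    (∀ j < k, ∀ b₁ b₂ : PBond P j, |Cloc P j (ρ j / 4) b₁ b₂| ≤ MC * Real.exp (-(δC * (supDist b₁.src b₂.src : ℝ)))) := by
  refine ⟨fun j hj _ μ ν x y => ?_, fun j hjk b₁ b₂ => ?_⟩
  · rcases Nat.eq_zero_or_pos j with hj0 | hj1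
    · subst hj0
      exact abs_H_zero_le hj ha hM δ μ ν x y
    · exact hH P hPd hPL j hj1 hj μ ν x y
  · have h := hC P hPd hPL j inferInstance (by omega) (ρ j / 4) b₁ b₂
    rwa [distB_apply] at h

/-- **THE KERNEL DECAY OF (2.13) OVER ALL TORI FROM [6I] PROP. 1.2 BY ITS TREE NAME** (`2 ≤ d`, `L` odd `> 1`): ONE `(R₀, c₀, δ′)`, `δ′ > 0`,
`c₀ ≥ 0`, with `|𝒟_{k,loc}(b,b″)| ≤ c₀e^{−δ′dist_k(b,b″)}` whenever `dist_k(b,b″) ≥ R₀`, for r18's `dkLocKer` at the printed weights on EVERY torus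
`P` (`P.d = d`, `P.L = L`), EVERY `k ≤ m + K` and EVERY radius schedule `ρ` — file 1's explicit `abs_dkLocKer_le` fed with p16's all-tori `|H|`
member (scale `0` by `abs_H_zero_le`) and p09's `(d, L)`-only `cloc_decay`: the constants of Sect. 2 are *"independent of k, T_η"*.
[cite: BalabanImbrieJaffe1988, (2.13) p.261] -/
theorem decayDkLoc_allTori_of_prop12Printed {d L : ℕ} (hd : 2 ≤ d) (hL : Odd L ∧ 1 < L) {a : ℝ} (ha : 0 < a)
    (h12 : B5.Prop12Printed (fun i : {x : Params × ℕ // x.1.d = d ∧ x.1.L = L ∧ 1 ≤ x.2 ∧ x.2 ≤ x.1.m + x.1.K} =>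
      settingOf (torusRep i.1.1 i.1.2 (deltaAData i.2.2.2.2 a)) i.1.2)) :
    ∃ R₀ c₀ δ' : ℝ, 0 < δ' ∧ 0 ≤ c₀ ∧ ∀ (P : Params) (_ : P.d = d) (_ : P.L = L) (k : ℕ) (_ : k ≤ P.m + P.K) (ρ : ℕ → ℝ)
      (b b'' : PBond P 0), R₀ ≤ kdist (P := P) k b b'' →
        |dkLocKer (P := P) ((P.eta k) ^ P.d) ((P.L : ℝ) ^ k) ρ k b b''| ≤ c₀ * Real.exp (-δ' * kdist (P := P) k b b'') := by
  obtain ⟨δ, M, hδ, hM, hH⟩ := exists_absH_le_allTori_of_prop12Printed (le_trans one_le_two hd) hL ha h12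
  obtain ⟨MC, δC, hMC, hδC, hC⟩ := cloc_decay d L hd
  refine ⟨2, M ^ 2 * MC * ((d : ℝ) ^ 2 * (Real.exp (min δ δC / 2 / 2) * ((2 * (1 + d / (min δ δC / 2))) ^ d) ^ 2)) *
      (((d - 2 + 1).factorial : ℝ) / (min δ δC / 2) ^ (d - 2 + 1)), min δ δC / 2 / 2, ?_, ?_,
    fun P hPd hPL k hk ρ b b'' hfar => ?_⟩
  · have := lt_min hδ hδC; positivity
  · have := lt_min hδ hδC; positivity
  obtain ⟨hHP, hCP⟩ := inputs_allTori ha hM hH hC hPd hPL hk ρ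
  subst hPd
  rw [neg_mul]
  exact abs_dkLocKer_le hd hk ha hδ hδC hMC.le hHP ρ hCP hfar

/-- **THE DIAGONAL SIZE OVER ALL TORI**: ONE `C ≥ 0` with `|𝒟_{k,loc}(b, b″)| ≤ C·Σ_{j<k}(L^{k−j})^{d−2}` for ALL `b, b″` on every torus
(`P.d = d`, `P.L = L`), every `k ≤ m + K`, every `ρ` (file 1's `abs_dkLocKer_le_diag`; `≤ 2C·η^{−(d−2)}` at `d ≥ 3`, `= C·k` at `d = 2`).
[cite: BalabanImbrieJaffe1988, (2.12) p.261] -/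
theorem diag_dkLoc_allTori_of_prop12Printed {d L : ℕ} (hd : 2 ≤ d) (hL : Odd L ∧ 1 < L) {a : ℝ} (ha : 0 < a)
    (h12 : B5.Prop12Printed (fun i : {x : Params × ℕ // x.1.d = d ∧ x.1.L = L ∧ 1 ≤ x.2 ∧ x.2 ≤ x.1.m + x.1.K} =>
      settingOf (torusRep i.1.1 i.1.2 (deltaAData i.2.2.2.2 a)) i.1.2)) :
    ∃ C : ℝ, 0 ≤ C ∧ ∀ (P : Params) (_ : P.d = d) (_ : P.L = L) (k : ℕ) (_ : k ≤ P.m + P.K) (ρ : ℕ → ℝ) (b b'' : PBond P 0),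
        |dkLocKer (P := P) ((P.eta k) ^ P.d) ((P.L : ℝ) ^ k) ρ k b b''| ≤
          C * ∑ j ∈ Finset.range k, ((P.L : ℝ) ^ (k - j)) ^ (P.d - 2) := by
  obtain ⟨δ, M, hδ, hM, hH⟩ := exists_absH_le_allTori_of_prop12Printed (le_trans one_le_two hd) hL ha h12
  obtain ⟨MC, δC, hMC, hδC, hC⟩ := cloc_decay d L hd
  refine ⟨M ^ 2 * MC * ((d : ℝ) ^ 2 * (Real.exp (min δ δC / 2 / 2) * ((2 * (1 + d / (min δ δC / 2))) ^ d) ^ 2)), ?_,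
    fun P hPd hPL k hk ρ b b'' => ?_⟩
  · have := lt_min hδ hδC; positivity
  obtain ⟨hHP, hCP⟩ := inputs_allTori ha hM hH hC hPd hPL hk ρ
  subst hPd
  exact abs_dkLocKer_le_diag hd hk ha hδ hδC hMC.le hHP ρ hCP b b''

/-- **(2.13) AS PRINTED, OVER ALL TORI FROM [6I] PROP. 1.2 BY ITS TREE NAME** (`2 ≤ d`, `L` odd `> 1`; the `η^d`-weighted action of file 2):
ONE `(c₁, δ′)`, `δ′ > 0`, `c₁ ≥ 0`, with `|Σ_{b″}η_k^d𝒟_{k,loc}(b,b″)f(b″)| ≤ c₁e^{−δ′dist_k(suppt f, b)}‖f‖_∞` for EVERY torus `P` (`P.d = d`,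
`P.L = L`), EVERY `k ≤ m + K`, EVERY radius schedule, every `f` and EVERY bond `b` — *"|(𝒟_{k,loc}f)(b)| ≦ ce^{−c dist(suppt f,b)}‖f‖_∞
(2.13)"* with `c` *"independent of k, T_η"* (file 2's explicit `abs_apply_dkLoc_le`). [cite: BalabanImbrieJaffe1988, (2.13) p.261] -/
theorem opDecay213_dkLoc_allTori_of_prop12Printed {d L : ℕ} (hd : 2 ≤ d) (hL : Odd L ∧ 1 < L) {a : ℝ} (ha : 0 < a)
    (h12 : B5.Prop12Printed (fun i : {x : Params × ℕ // x.1.d = d ∧ x.1.L = L ∧ 1 ≤ x.2 ∧ x.2 ≤ x.1.m + x.1.K} =>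
      settingOf (torusRep i.1.1 i.1.2 (deltaAData i.2.2.2.2 a)) i.1.2)) :
    ∃ c₁ δ' : ℝ, 0 < δ' ∧ 0 ≤ c₁ ∧ ∀ (P : Params) (_ : P.d = d) (_ : P.L = L) (k : ℕ) (_ : k ≤ P.m + P.K) (ρ : ℕ → ℝ)
      (f : PBond P 0 → ℝ) (b : PBond P 0),
        |applyK (fun b b'' => (P.eta k) ^ P.d * dkLocKer (P := P) ((P.eta k) ^ P.d) ((P.L : ℝ) ^ k) ρ k b b'') f b| ≤
          c₁ * Real.exp (-δ' * suppDist (fun a b => kdist (P := P) k a b) f b) * supNorm f := by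
  obtain ⟨δ, M, hδ, hM, hH⟩ := exists_absH_le_allTori_of_prop12Printed (le_trans one_le_two hd) hL ha h12
  obtain ⟨MC, δC, hMC, hδC, hC⟩ := cloc_decay d L hd
  refine ⟨M ^ 2 * MC * (d : ℝ) ^ 3 * (Real.exp (min δ δC / 2 / 2) * ((2 * (1 + d / (min δ δC / 2))) ^ d) ^ 3),
    min δ δC / 2, half_pos (lt_min hδ hδC), ?_, fun P hPd hPL k hk ρ f b => ?_⟩
  · have := lt_min hδ hδC; positivity
  obtain ⟨hHP, hCP⟩ := inputs_allTori ha hM hH hC hPd hPL hk ρ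
  subst hPd
  exact abs_apply_dkLoc_le hd hk ha hδ hδC hMC.le hHP ρ hCP f b

/-- `dist(suppt f, b)` scales with the distance: `suppDist (κ·dist) f b = κ·suppDist dist f b` for `κ ≥ 0`. [folklore] -/
private theorem suppDist_smul' {α β : Type*} {dist : α → β → ℝ} {κ : ℝ} (hκ : 0 ≤ κ) (f : α → ℝ) (b : β) :
    suppDist (fun a b => κ * dist a b) f b = κ * suppDist dist f b := by
  unfold suppDist
  rw [Real.mul_iInf_of_nonneg hκ]

/-- **r18's typed row `OpDecay (κ·dist_k) 𝒟_{k,loc} c` OVER ALL TORI with ONE `(κ, c)`** (`κ, c > 0`; rescaled distance, as every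
one-letter row of this section), from the all-tori [6I] Prop. 1.2. [cite: BalabanImbrieJaffe1988, (2.13) p.261] -/
theorem opDecay213_dkLoc_typed_allTori_of_prop12Printed {d L : ℕ} (hd : 2 ≤ d) (hL : Odd L ∧ 1 < L) {a : ℝ} (ha : 0 < a)
    (h12 : B5.Prop12Printed (fun i : {x : Params × ℕ // x.1.d = d ∧ x.1.L = L ∧ 1 ≤ x.2 ∧ x.2 ≤ x.1.m + x.1.K} =>
      settingOf (torusRep i.1.1 i.1.2 (deltaAData i.2.2.2.2 a)) i.1.2)) :
    ∃ κ c : ℝ, 0 < κ ∧ 0 < c ∧ ∀ (P : Params) (_ : P.d = d) (_ : P.L = L) (k : ℕ) (_ : k ≤ P.m + P.K) (ρ : ℕ → ℝ),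
      OpDecay (fun a b => κ * kdist (P := P) k a b)
        (fun b b'' => (P.eta k) ^ P.d * dkLocKer (P := P) ((P.eta k) ^ P.d) ((P.L : ℝ) ^ k) ρ k b b'') c := by
  obtain ⟨c₁, δ', hδ', hc₁, H⟩ := opDecay213_dkLoc_allTori_of_prop12Printed hd hL ha h12
  have hc : 0 < max c₁ δ' := lt_max_of_lt_right hδ'
  refine ⟨δ' / max c₁ δ', max c₁ δ', by positivity, hc, fun P hPd hPL k hk ρ f b => ?_⟩
  have h := H P hPd hPL k hk ρ f b
  have hκ : 0 ≤ δ' / max c₁ δ' := by positivity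
  rw [suppDist_smul' hκ]
  have e : -max c₁ δ' * (δ' / max c₁ δ' * suppDist (fun a b => kdist (P := P) k a b) f b) =
      -δ' * suppDist (fun a b => kdist (P := P) k a b) f b := by
    field_simp
  rw [e]
  exact h.trans (mul_le_mul_of_nonneg_right (mul_le_mul_of_nonneg_right (le_max_left _ _) (Real.exp_pos _).le)
    (supNorm_nonneg f))

end AllTori

end

end Literature.MathematicalPhysics.QuantumFieldTheory.BalabanImbrieJaffe1984to88.BIJ88Decay213DkLocAllTori
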